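import Literature.NumberTheory.EllipticCurves.ComplexMultiplicationDeuringRamifiedProofs
import Literature.NumberTheory.EllipticCurves.CongruentNumberCurveMinimalAtTwo
import HarnessLib

/-!
# Deuring at the ramified prime for `j = 1728`: the `ℚ`-side (`y² = x³ + Ax` is additive at `2`)

Sibling proof file of `Literature.NumberTheory.EllipticCurves.ComplexMultiplicationDeuringRamifiedProofs`
(D-0014 append protocol; everything here is proved, no definitions). That file proved the
ramified statement `hR` of Deuring's theorem for `j ≠ 1728` and reduced Deuring's
`L(E_K/K, s) = L(E/ℚ, s)²` to the inert statement `hI` and the ramified statement at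
`j = 1728` (`h1728`): for an elliptic `W/ℚ` with `j(W) = 1728`, `K = ℚ(i)` its CM field and `w`
the place of `K` above `2` (ramification index `2`), both local Euler factors `L_w(W_K)` and
`L_2(W)` are `1`. Here `W ≅ y² = x³ + Ax` with `A = 2^r A₀ ∈ ℤ`, `A₀` odd, `r ∈ {0, 1, 2, 3}`
(short Weierstrass form with `a₆ = 0`, rescaled), `Δ = -2⁶A³`, `c₄ = -48A`, so
`ord₂ Δ = 6 + 3r ∈ {6, 9, 12, 15}`:

* `r = 1, 3`: `6 ∤ ord₂ Δ`, and the engine of the ramified file settles both sides;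
* `r = 0`: `ord₂ Δ = 6 < 12`, so the equation is minimal and additive at `2` over `ℚ`;
* `r = 2`: `ord₂ Δ = 12` and Silverman's Remark VII.1.1 does not apply; **this file proves that
  `y² = x³ + 4mx`, `m` odd, is nevertheless a minimal equation at `2`**
  (`isMinimalAt_two_mk_four_mul_odd`), by the direct argument of *AEC* VII.1 used in the tree for
  the congruent number curves `y² = x³ - (2m)²x` (`isMinimalAt_congruentNumberCurve_two_of_even`,
  whose `2`-adic lemmas are reused): if `[u, r, s, t] • E` were `2`-integral with `|u|₂ < 1` then
  `ord₂ u = 1`, `s ∈ ℤ₂`, `4 ∣ 3r - s²`, `4 ∣ t`, `16 ∣ 4m + 3r² - 2st`; `s` even forces `4 ∣ r`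
  and `16 ∣ 4m`, `s` odd forces `r` odd and `4m + 3r² - 2st ≡ 4 + 3 - 0 ≡ -1 (mod 8)`, a unit;
  hence additive reduction at `2` over `ℚ` (`hasAdditiveReductionAt_two_mk_four_mul_odd`).

Consequently (`localEulerFactor_eq_one_of_j_eq_1728_rat`) **`L_2(W) = 1` for every elliptic
`W/ℚ` with `j(W) = 1728`** — the `ℚ`-half of `h1728` (Silverman, *Advanced Topics*,
Ex. 2.31(a), 2.32(a) for `E = y² = x³ + Ax`, `K = ℚ(i)`, `p = 2`); and the `K`-half is reduced
to the single statement that `y² = x³ + mx`, `m` odd, has additive reduction over `K` at `w`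
(`h1728_of_odd`: the cases `r = 1, 3` by the engine, `r = 2 ↦ r = 0` by the `K`-isomorphism
`u = 1 + θ/2`, `u⁴ = -4`), which is the genuinely wild computation over `𝓞_w ≅ ℤ₂[i]` left open.

## References

* J. H. Silverman, *The Arithmetic of Elliptic Curves*, 2nd ed. (2009), VII.1 (Remark 1.1,
  Prop. 1.3), VII.5 Prop. 5.1(c), X.5.4. [SilvermanAEC2009]
* J. H. Silverman, *Advanced Topics* (1994), Ch. II Exercises 2.31(a), 2.32, 2.33
  (`y² = x³ - Dx`). [SilvermanATAEC1994]
-/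

noncomputable section

open scoped Classical

open IsDedekindDomain NumberField Rat.HeightOneSpectrum WeierstrassCurve

namespace Literature.NumberTheory.EllipticCurves

/-! ### `2`-adic values of small integers and of odd integers -/

section TwoAdic

variable (v : HeightOneSpectrum (𝓞 ℚ))

/-- At the place over `2`: an odd integer is a `v`-adic unit. [folklore] -/
theorem valued_intCast_of_odd (hv : natGenerator v = 2) {m : ℤ} (hm : Odd m) :
    Valued.v (m : v.adicCompletion ℚ) = 1 := by
  have h2m : ¬ (natGenerator v : ℤ) ∣ m := by
    rw [hv]
    intro h
    exact Int.not_even_iff_odd.mpr hm (even_iff_two_dvd.mpr (by exact_mod_cast h))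
  have h := Literature.NumberTheory.GaloisRepresentations.Rat.valuation_intCast_eq_one v h2m
  rw [← map_intCast (algebraMap ℚ (v.adicCompletion ℚ)) m,
    GaloisRepresentations.valued_algebraMap_adicCompletion]
  exact h

/-- At the place over `2`: `|m - 1|_v ≤ exp(-1)` for an odd integer `m`. [folklore] -/
theorem valued_intCast_sub_one_of_odd (hv : natGenerator v = 2) {m : ℤ} (hm : Odd m) :
    Valued.v ((m : v.adicCompletion ℚ) - 1) ≤ WithZero.exp (-1 : ℤ) := by
  have hdvd : (natGenerator v : ℤ) ^ 1 ∣ m - 1 := by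
    rw [hv, pow_one]
    obtain ⟨k, rfl⟩ := hm
    exact ⟨k, by ring⟩
  have h := Literature.NumberTheory.GaloisRepresentations.Rat.valuation_intCast_le v hdvd
  have hcast : ((m : v.adicCompletion ℚ) - 1) = algebraMap ℚ (v.adicCompletion ℚ) ((m - 1 : ℤ) : ℚ) := by
    rw [map_intCast, Int.cast_sub, Int.cast_one]
  rw [hcast, GaloisRepresentations.valued_algebraMap_adicCompletion]
  exact_mod_cast h

end TwoAdic

/-! ### Minimality of `y² = x³ + 4mx` at `2` for odd `m` -/

section Minimal

variable (v : HeightOneSpectrum (𝓞 ℚ))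

/-- `|Δ(y² = x³ + 4mx)|_v = |-2¹²m³|_v = exp(-12)` at the place over `2`, `m` odd. [folklore] -/
theorem valuation_Δ_mk_four_mul_odd (hv : natGenerator v = 2) {m : ℤ} (hm : Odd m) :
    v.valuation ℚ (⟨0, 0, 0, 4 * (m : ℚ), 0⟩ : WeierstrassCurve ℚ).Δ = WithZero.exp (-12 : ℤ) := by
  have hΔ : (⟨0, 0, 0, 4 * (m : ℚ), 0⟩ : WeierstrassCurve ℚ).Δ = -((2 : ℚ) ^ 12 * (m : ℚ) ^ 3) := by
    simp only [WeierstrassCurve.Δ, WeierstrassCurve.b₂, WeierstrassCurve.b₄, WeierstrassCurve.b₆,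
      WeierstrassCurve.b₈]
    ring
  have hv2 : v.valuation ℚ (2 : ℚ) = WithZero.exp (-1 : ℤ) := by
    have := Literature.NumberTheory.GaloisRepresentations.Rat.valuation_natGenerator v
    rwa [hv, Nat.cast_ofNat] at this
  have hvm : v.valuation ℚ (m : ℚ) = 1 := by
    have h2m : ¬ (natGenerator v : ℤ) ∣ m := by
      rw [hv]
      intro h
      exact Int.not_even_iff_odd.mpr hm (even_iff_two_dvd.mpr (by exact_mod_cast h))
    exact Literature.NumberTheory.GaloisRepresentations.Rat.valuation_intCast_eq_one v h2m
  rw [hΔ, Valuation.map_neg, Valuation.map_mul, Valuation.map_pow, Valuation.map_pow, hv2, hvm,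
    one_pow, mul_one, ← WithZero.exp_nsmul]
  norm_num

/-- **`y² = x³ + 4mx` is a minimal Weierstrass equation at `2` for odd `m`** (Silverman,
*AEC* VII.1; here `ord₂(Δ) = 12` and Remark VII.1.1 does not apply). Same argument as the tree's
`isMinimalAt_congruentNumberCurve_two_of_even` (the case `4m = -(2m')²`): if
`[u, r, s, t] • E` is `2`-integral with `|u|₂ < 1`, integrality of `Δ' = u⁻¹²Δ` gives
`ord₂ u = 1`; then `a₁' = 2s/u`, `a₃' = 2t/u³`, `a₂' = (3r - s²)/u²`,
`a₄' = (4m + 3r² - 2st)/u⁴` integral give `|s| ≤ 1`, `|t| ≤ exp(-2)`, `|3r - s²| ≤ exp(-2)`,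
`|4m + 3r² - 2st| ≤ exp(-4)`. If `|s| < 1` then `|r| ≤ exp(-2)` and `|4m| ≤ exp(-4)`,
contradicting `|4m| = exp(-2)`. If `|s| = 1` then `s² ≡ 1 (8)`, `3r ≡ 1 (4)`, `r` is a unit,
`3r² ≡ 3 (8)`, `4m ≡ 4 (8)`, `2st ≡ 0 (8)`, whence `4m + 3r² - 2st ≡ -1 (8)` is a unit,
contradicting `|…| ≤ exp(-4)`.
[cite: SilvermanAEC2009, VII.1 (minimal Weierstrass equations; Remark 1.1, Prop. 1.3)] -/
theorem isMinimalAt_two_mk_four_mul_odd (hv : natGenerator v = 2) {m : ℤ} (hm : Odd m) :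
    (⟨0, 0, 0, 4 * (m : ℚ), 0⟩ : WeierstrassCurve ℚ).IsMinimalAt v := by
  have V2 := valued_two v hv
  have V3 := valued_three v hv
  have V4 := valued_four v hv
  have Vm := valued_intCast_of_odd v hv hm
  set W : WeierstrassCurve ℚ := ⟨0, 0, 0, 4 * (m : ℚ), 0⟩ with hW
  set X : WeierstrassCurve (v.adicCompletion ℚ) := W.baseChange (v.adicCompletion ℚ) with hX
  have hXa₁ : X.a₁ = 0 := by simp [hX, hW, baseChange]
  have hXa₂ : X.a₂ = 0 := by simp [hX, hW, baseChange]
  have hXa₃ : X.a₃ = 0 := by simp [hX, hW, baseChange]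
  have hXa₄ : X.a₄ = 4 * (m : v.adicCompletion ℚ) := by
    rw [hX, baseChange, map_a₄, hW]
    simp only [map_mul, map_ofNat, map_intCast]
  have hXΔ : Valued.v X.Δ = WithZero.exp (-12 : ℤ) := by
    rw [hX, baseChange, map_Δ, GaloisRepresentations.valued_algebraMap_adicCompletion,
      valuation_Δ_mk_four_mul_odd v hv hm]
  have hV1 : ∀ x : v.adicCompletion ℚ,
      x ∈ (algebraMap (v.adicCompletionIntegers ℚ) (v.adicCompletion ℚ)).range → Valued.v x ≤ 1 :=
    fun x hx ↦ (valued_le_one_iff_mem_range_adicCompletionIntegers v x).mpr hx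
  show X.IsMinimal (v.adicCompletionIntegers ℚ)
  rw [isMinimal_iff_of_le_one_iff (valued_le_one_iff_mem_range_adicCompletionIntegers v)]
  refine ⟨?_, fun C hC ↦ ?_⟩
  · refine W.isIntegralAt_of_valuation_le_one v ?_ ?_ ?_ ?_ ?_
    · simp only [hW, Valuation.map_zero]; exact zero_le
    · simp only [hW, Valuation.map_zero]; exact zero_le
    · simp only [hW, Valuation.map_zero]; exact zero_le
    · show v.valuation ℚ (4 * (m : ℚ)) ≤ 1
      exact_mod_cast Rat.valuation_intCast_le_one v (4 * m)
    · simp only [hW, Valuation.map_zero]; exact zero_le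
  -- integrality of the transformed coefficients and discriminant
  obtain ⟨h1, h2, h3, h4, -⟩ := (isIntegral_iff_forall_mem_range (C • X)).mp hC
  replace h1 := hV1 _ h1
  replace h2 := hV1 _ h2
  replace h3 := hV1 _ h3
  replace h4 := hV1 _ h4
  have e1 : (C • X).a₁ = ↑C.u⁻¹ * (2 * C.s) := by rw [variableChange_a₁, hXa₁, zero_add]
  have e2 : (C • X).a₂ = ↑C.u⁻¹ ^ 2 * (3 * C.r - C.s ^ 2) := by
    rw [variableChange_a₂, hXa₁, hXa₂]; ring
  have e3 : (C • X).a₃ = ↑C.u⁻¹ ^ 3 * (2 * C.t) := by rw [variableChange_a₃, hXa₁, hXa₃]; ring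
  have e4 : (C • X).a₄ = ↑C.u⁻¹ ^ 4 *
      (4 * (m : v.adicCompletion ℚ) + 3 * C.r ^ 2 - 2 * C.s * C.t) := by
    rw [variableChange_a₄, hXa₁, hXa₂, hXa₃, hXa₄]; ring
  rw [e1, Valuation.map_mul] at h1
  rw [e2, Valuation.map_mul, Valuation.map_pow] at h2
  rw [e3, Valuation.map_mul, Valuation.map_pow] at h3
  rw [e4, Valuation.map_mul, Valuation.map_pow] at h4
  have hΔ' : Valued.v (C • X).Δ ≤ 1 := by
    obtain ⟨d, hd⟩ := Δ_integral_of_isIntegral (v.adicCompletionIntegers ℚ) (C • X)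
    rw [← hd]
    exact hV1 _ ⟨d, rfl⟩
  rw [variableChange_Δ, Valuation.map_mul, Valuation.map_pow, hXΔ] at hΔ'
  rw [variableChange_Δ, Valuation.map_mul, Valuation.map_pow, hXΔ]
  set U : WithZero (Multiplicative ℤ) := Valued.v (↑C.u⁻¹ : v.adicCompletion ℚ) with hU
  by_cases hU1 : U ≤ 1
  · calc U ^ 12 * WithZero.exp (-12 : ℤ) ≤ 1 * WithZero.exp (-12 : ℤ) :=
          mul_le_mul' (pow_le_one' hU1 _) le_rfl
      _ = WithZero.exp (-12 : ℤ) := one_mul _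
  exfalso
  replace hU1 : 1 < U := not_le.mp hU1
  have hU0 : U ≠ 0 := (Valuation.ne_zero_iff _).mpr (Units.ne_zero _)
  -- `ord(u) = 1`
  have hUe : U = WithZero.exp (1 : ℤ) := by
    have hl1 : 0 < WithZero.log U := WithZero.lt_log_of_exp_lt (by rwa [WithZero.exp_zero])
    have hl2 : 12 * WithZero.log U + (-12) ≤ 0 := by
      have hne : U ^ 12 * WithZero.exp (-12 : ℤ) ≠ 0 :=
        mul_ne_zero (pow_ne_zero _ hU0) WithZero.exp_ne_zero
      have := (WithZero.log_le_log hne one_ne_zero).mpr hΔ'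
      rw [WithZero.log_mul (pow_ne_zero _ hU0) WithZero.exp_ne_zero, WithZero.log_pow,
        WithZero.log_exp, WithZero.log_one] at this
      simpa [nsmul_eq_mul] using this
    have hlog : WithZero.log U = 1 := by omega
    rw [← WithZero.exp_log hU0, hlog]
  have hUe2 : U ^ 2 = WithZero.exp (2 : ℤ) := by rw [hUe, ← WithZero.exp_nsmul]; norm_num
  have hUe3 : U ^ 3 = WithZero.exp (3 : ℤ) := by rw [hUe, ← WithZero.exp_nsmul]; norm_num
  have hUe4 : U ^ 4 = WithZero.exp (4 : ℤ) := by rw [hUe, ← WithZero.exp_nsmul]; norm_num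
  rw [hUe] at h1
  rw [hUe2] at h2
  rw [hUe3] at h3
  rw [hUe4] at h4
  -- `|s| ≤ 1`, `|t| ≤ exp(-2)`, `|3r - s²| ≤ exp(-2)`, `|E| ≤ exp(-4)`
  have hs : Valued.v C.s ≤ 1 := by
    have h := withZero_le_exp_neg_of_exp_mul_le h1
    rw [Valuation.map_mul, V2] at h
    exact withZero_le_of_exp_mul_le_exp_mul (k := -1) (by rwa [mul_one])
  have ht : Valued.v C.t ≤ WithZero.exp (-2 : ℤ) := by
    have h := withZero_le_exp_neg_of_exp_mul_le h3
    rw [Valuation.map_mul, V2] at h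
    refine withZero_le_of_exp_mul_le_exp_mul (k := -1) ?_
    rw [withZero_exp_mul_exp]
    norm_num
    exact h
  have hrs : Valued.v (3 * C.r - C.s ^ 2) ≤ WithZero.exp (-2 : ℤ) :=
    withZero_le_exp_neg_of_exp_mul_le h2
  have hE : Valued.v (4 * (m : v.adicCompletion ℚ) + 3 * C.r ^ 2 - 2 * C.s * C.t) ≤
      WithZero.exp (-4 : ℤ) :=
    withZero_le_exp_neg_of_exp_mul_le h4
  have hn2 : Valued.v (4 * (m : v.adicCompletion ℚ)) = WithZero.exp (-2 : ℤ) := by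
    rw [Valuation.map_mul, V4, Vm, mul_one]
  rcases hs.lt_or_eq with hslt | hseq
  · -- Case `|s| < 1`: then `4 ∣ r` and `16 ∣ 4m`
    have hs1 : Valued.v C.s ≤ WithZero.exp (-1 : ℤ) := by
      have := withZero_le_exp_sub_one_of_lt_exp (k := 0) (by rwa [WithZero.exp_zero])
      simpa using this
    have hs2 : Valued.v (C.s ^ 2) ≤ WithZero.exp (-2 : ℤ) := by
      rw [Valuation.map_pow, pow_two]
      calc Valued.v C.s * Valued.v C.s ≤ WithZero.exp (-1 : ℤ) * WithZero.exp (-1 : ℤ) :=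
            mul_le_mul' hs1 hs1
        _ = WithZero.exp (-2 : ℤ) := by rw [withZero_exp_mul_exp]; norm_num
    have h3r : Valued.v (3 * C.r) ≤ WithZero.exp (-2 : ℤ) := by
      have : (3 : v.adicCompletion ℚ) * C.r = (3 * C.r - C.s ^ 2) + C.s ^ 2 := by ring
      rw [this]
      exact Valuation.map_add_le _ hrs hs2
    have hr2 : Valued.v C.r ≤ WithZero.exp (-2 : ℤ) := by
      rwa [Valuation.map_mul, V3, one_mul] at h3r
    have h3r2 : Valued.v (3 * C.r ^ 2) ≤ WithZero.exp (-4 : ℤ) := by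
      rw [Valuation.map_mul, V3, one_mul, Valuation.map_pow, pow_two]
      calc Valued.v C.r * Valued.v C.r ≤ WithZero.exp (-2 : ℤ) * WithZero.exp (-2 : ℤ) :=
            mul_le_mul' hr2 hr2
        _ = WithZero.exp (-4 : ℤ) := by rw [withZero_exp_mul_exp]; norm_num
    have h2st : Valued.v (2 * C.s * C.t) ≤ WithZero.exp (-4 : ℤ) := by
      rw [Valuation.map_mul, Valuation.map_mul, V2]
      calc WithZero.exp (-1 : ℤ) * Valued.v C.s * Valued.v C.t
          ≤ WithZero.exp (-1 : ℤ) * WithZero.exp (-1 : ℤ) * WithZero.exp (-2 : ℤ) :=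
            mul_le_mul' (mul_le_mul' le_rfl hs1) ht
        _ = WithZero.exp (-4 : ℤ) := by rw [withZero_exp_mul_exp, withZero_exp_mul_exp]; norm_num
    have hn2' : Valued.v (4 * (m : v.adicCompletion ℚ)) ≤ WithZero.exp (-4 : ℤ) := by
      have : (4 * (m : v.adicCompletion ℚ)) =
          (4 * (m : v.adicCompletion ℚ) + 3 * C.r ^ 2 - 2 * C.s * C.t) -
            (3 * C.r ^ 2 - 2 * C.s * C.t) := by ring
      rw [this]
      exact Valuation.map_sub_le _ hE (Valuation.map_sub_le _ h3r2 h2st)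
    rw [hn2, WithZero.exp_le_exp] at hn2'
    norm_num at hn2'
  · -- Case `|s| = 1`: then `r` is a unit and `4m + 3r² - 2st ≡ -1 (mod 8)`
    have hs21 := valued_sq_sub_one_le_of_valued_eq_one v hv hseq
    have h3r1 : Valued.v (3 * C.r - 1) ≤ WithZero.exp (-2 : ℤ) := by
      have : (3 : v.adicCompletion ℚ) * C.r - 1 = (3 * C.r - C.s ^ 2) + (C.s ^ 2 - 1) := by ring
      rw [this]
      exact Valuation.map_add_le _ hrs
        (hs21.trans (by rw [WithZero.exp_le_exp]; norm_num))
    have hlt1 : WithZero.exp (-2 : ℤ) < 1 := by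
      rw [← WithZero.exp_zero, WithZero.exp_lt_exp]; norm_num
    have hr1 : Valued.v C.r = 1 := by
      have h3r : Valued.v (3 * C.r) = 1 := by
        have : (3 : v.adicCompletion ℚ) * C.r = 1 + (3 * C.r - 1) := by ring
        rw [this, Valuation.map_add_eq_of_lt_left, Valuation.map_one]
        rw [Valuation.map_one]
        exact lt_of_le_of_lt h3r1 hlt1
      rwa [Valuation.map_mul, V3, one_mul] at h3r
    have hr21 := valued_sq_sub_one_le_of_valued_eq_one v hv hr1
    have hm1 := valued_intCast_sub_one_of_odd v hv hm
    have hA : Valued.v (3 * C.r ^ 2 - 3) ≤ WithZero.exp (-3 : ℤ) := by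
      have : (3 : v.adicCompletion ℚ) * C.r ^ 2 - 3 = 3 * (C.r ^ 2 - 1) := by ring
      rw [this, Valuation.map_mul, V3, one_mul]
      exact hr21
    have hB : Valued.v (4 * (m : v.adicCompletion ℚ) - 4) ≤ WithZero.exp (-3 : ℤ) := by
      have : (4 * (m : v.adicCompletion ℚ) - 4) = 4 * ((m : v.adicCompletion ℚ) - 1) := by ring
      rw [this, Valuation.map_mul, V4]
      calc WithZero.exp (-2 : ℤ) * Valued.v ((m : v.adicCompletion ℚ) - 1)
          ≤ WithZero.exp (-2 : ℤ) * WithZero.exp (-1 : ℤ) := mul_le_mul' le_rfl hm1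
        _ = WithZero.exp (-3 : ℤ) := by rw [withZero_exp_mul_exp]; norm_num
    have hC' : Valued.v (2 * C.s * C.t) ≤ WithZero.exp (-3 : ℤ) := by
      rw [Valuation.map_mul, Valuation.map_mul, V2, hseq, mul_one]
      calc WithZero.exp (-1 : ℤ) * Valued.v C.t ≤ WithZero.exp (-1 : ℤ) * WithZero.exp (-2 : ℤ) :=
            mul_le_mul' le_rfl ht
        _ = WithZero.exp (-3 : ℤ) := by rw [withZero_exp_mul_exp]; norm_num
    have hbr : Valued.v ((4 * (m : v.adicCompletion ℚ) - 4) + (3 * C.r ^ 2 - 3) -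
        2 * C.s * C.t) ≤ WithZero.exp (-3 : ℤ) :=
      Valuation.map_sub_le _ (Valuation.map_add_le _ hB hA) hC'
    have hlt3 : WithZero.exp (-3 : ℤ) < 1 := by
      rw [← WithZero.exp_zero, WithZero.exp_lt_exp]; norm_num
    have hE1 : Valued.v (4 * (m : v.adicCompletion ℚ) + 3 * C.r ^ 2 - 2 * C.s * C.t) = 1 := by
      have : 4 * (m : v.adicCompletion ℚ) + 3 * C.r ^ 2 - 2 * C.s * C.t =
          7 + ((4 * (m : v.adicCompletion ℚ) - 4) + (3 * C.r ^ 2 - 3) - 2 * C.s * C.t) := by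
        ring
      have h7 : Valued.v (7 : v.adicCompletion ℚ) = 1 := by
        have := valued_natCast_of_odd v hv (m := 7) (by decide)
        exact_mod_cast this
      rw [this, Valuation.map_add_eq_of_lt_left, h7]
      rw [h7]
      exact lt_of_le_of_lt hbr hlt3
    rw [hE1, ← WithZero.exp_zero, WithZero.exp_le_exp] at hE
    norm_num at hE

/-- **`y² = x³ + 4mx` has additive reduction at `2` for odd `m`**: the equation is minimal at
`2` (`isMinimalAt_two_mk_four_mul_odd`) with `ord₂(Δ) = 12 > 0` and `ord₂(c₄) = ord₂(-192m) > 0`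
(Silverman VII.5, Prop. 5.1(c); the tree's `hasAdditiveReductionAt_of_isMinimalAt`).
[cite: SilvermanAEC2009, VII.5 Prop. 5.1(c) and VII.1 Prop. 1.3(b)] -/
theorem hasAdditiveReductionAt_two_mk_four_mul_odd (hv : natGenerator v = 2) {m : ℤ} (hm : Odd m) :
    (⟨0, 0, 0, 4 * (m : ℚ), 0⟩ : WeierstrassCurve ℚ).HasAdditiveReductionAt v := by
  have hmin := isMinimalAt_two_mk_four_mul_odd v hv hm
  have hΔ := valuation_Δ_mk_four_mul_odd v hv hm
  refine hasAdditiveReductionAt_of_isMinimalAt v _ hmin ?_ ?_ ?_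
  · rw [hΔ, ← WithZero.exp_zero, WithZero.exp_lt_exp]; norm_num
  · have hc₄ : (⟨0, 0, 0, 4 * (m : ℚ), 0⟩ : WeierstrassCurve ℚ).c₄ = ((-192 * m : ℤ) : ℚ) := by
      simp only [WeierstrassCurve.c₄, WeierstrassCurve.b₂, WeierstrassCurve.b₄]
      push_cast
      ring
    have hdvd : (natGenerator v : ℤ) ^ 1 ∣ -192 * m := by rw [hv]; exact ⟨-96 * m, by ring⟩
    rw [hc₄]
    exact lt_of_le_of_lt (Literature.NumberTheory.GaloisRepresentations.Rat.valuation_intCast_le v hdvd)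
      (by rw [← WithZero.exp_zero, WithZero.exp_lt_exp]; norm_num)
  · intro h0
    rw [h0, Valuation.map_zero] at hΔ
    exact WithZero.exp_ne_zero hΔ.symm

end Minimal

/-! ### The normal form `y² = x³ + 2^r A₀ x` of a curve with `j = 1728` -/

section NormalForm

/-- **Curves with `j = 1728` are `y² = x³ + Ax` with `A = 2^r A₀`, `A₀` odd, `r < 4`**, up to
`ℚ`-isomorphism: on a short model `y² = x³ + a₄x + a₆` (`exists_variableChange_isShortNF`),
`j = 6912a₄³/(4a₄³ + 27a₆²) = 1728` forces `a₆ = 0` and `a₄ ≠ 0`; rescaling by `u = 1/den(a₄)`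
and then by `u = 2^k` makes `a₄` an integer with `ord₂ a₄ < 4` (Silverman, *AEC* X.5.4(iii):
the twists of `j = 1728` are the `y² = x³ + Dx`, `D ∈ ℚ*/ℚ*⁴`). [folklore] -/
theorem exists_variableChange_eq_of_j_eq_1728 (W : WeierstrassCurve ℚ) [W.IsElliptic]
    (hj : W.j = 1728) :
    ∃ (r : ℕ) (A₀ : ℤ) (C : VariableChange ℚ), r < 4 ∧ Odd A₀ ∧
      C • W = ⟨0, 0, 0, (2 : ℚ) ^ r * A₀, 0⟩ := by
  -- a short model `S = C • W : y² = x³ + a₄ x + a₆`, with `a₆ = 0`, `a₄ ≠ 0`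
  obtain ⟨C, hC⟩ := W.exists_variableChange_isShortNF
  haveI := hC
  have hjS : (C • W).j = 1728 := by rw [variableChange_j]; exact hj
  have hden := four_mul_a₄_cube_add_ne_zero (C • W)
  have hj' := (C • W).j_of_isShortNF
  rw [hjS, eq_div_iff hden] at hj'
  have hB : (C • W).a₆ = 0 := by nlinarith [sq_nonneg ((C • W).a₆)]
  have hA : (C • W).a₄ ≠ 0 := by
    intro hA; apply hden; rw [hA, hB]; ring
  set a : ℚ := (C • W).a₄ with ha_def
  have hS : C • W = ⟨0, 0, 0, a, 0⟩ := by
    ext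
    · exact a₁_of_isShortNF _
    · exact a₂_of_isShortNF _
    · exact a₃_of_isShortNF _
    · rfl
    · exact hB
  -- clear denominators: `A₁ = a · den(a)⁴ ∈ ℤ`
  set u₁ : ℚ := (a.den : ℚ)⁻¹ with hu₁_def
  have hu₁ : u₁ ≠ 0 := inv_ne_zero (by exact_mod_cast a.den_nz)
  set A₁ : ℤ := a.num * a.den ^ 3 with hA₁_def
  have haA₁ : (a.den : ℚ) ^ 4 * a = (A₁ : ℚ) := by
    rw [hA₁_def, Int.cast_mul, Int.cast_pow, Int.cast_natCast, ← Rat.mul_den_eq_num a]; ring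
  have hA₁0 : A₁ ≠ 0 :=
    mul_ne_zero (Rat.num_ne_zero.mpr hA) (pow_ne_zero _ (by exact_mod_cast a.den_nz))
  -- `A₁ = 2^e A₀`, `A₀` odd; `e = 4k + r`
  obtain ⟨e, A₀, hA₁, hA₀⟩ := Int.exists_eq_pow_mul_not_dvd Nat.prime_two hA₁0
  have hA₀odd : Odd A₀ := Int.not_even_iff_odd.mp fun h ↦ hA₀ (even_iff_two_dvd.mp h)
  set k := e / 4 with hk
  set r := e % 4 with hr
  have her : e = 4 * k + r := (Nat.div_add_mod e 4).symm
  set u₂ : ℚ := (2 : ℚ) ^ k with hu₂_def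
  have hu₂ : u₂ ≠ 0 := pow_ne_zero _ two_ne_zero
  refine ⟨r, A₀, (⟨Units.mk0 u₂ hu₂, 0, 0, 0⟩ : VariableChange ℚ) *
    ((⟨Units.mk0 u₁ hu₁, 0, 0, 0⟩ : VariableChange ℚ) * C), Nat.mod_lt e (by norm_num), hA₀odd, ?_⟩
  rw [mul_smul, mul_smul, hS]
  ext
  · simp [variableChange_a₁]
  · simp [variableChange_a₂]
  · simp [variableChange_a₃]
  · simp only [variableChange_a₄, variableChange_a₁, variableChange_a₂, variableChange_a₃,
      Units.val_inv_eq_inv_val, Units.val_mk0, hu₁_def, hu₂_def, inv_inv, mul_zero, zero_mul,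
      sub_zero, add_zero, inv_pow]
    rw [show (a.den : ℚ) ^ 4 * (a + 3 * 0 ^ 2) + 3 * 0 ^ 2 = (A₁ : ℚ) by rw [← haA₁]; ring, hA₁,
      her]
    push_cast
    field_simp
    ring
  · simp [variableChange_a₆]

end NormalForm

/-! ### The `ℚ`-side: `L_2(W) = 1` for `j(W) = 1728` -/

section RatSide

variable (v : HeightOneSpectrum (𝓞 ℚ))

/-- `y² = x³ + 2^r A₀ x` (`A₀` odd, `r < 4`) has additive reduction at `2`: for `r ≠ 2`,
`ord₂ Δ = 6 + 3r ∉ 12ℤ` and `3 ord₂ c₄ = 3(4 + r) ≥ ord₂ Δ` (Silverman VII.5.1(c) via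
`hasAdditiveReductionAt_of_valuation_Δ_of_cube_le`); for `r = 2` the minimality argument
`hasAdditiveReductionAt_two_mk_four_mul_odd`. [cite: SilvermanAEC2009, VII.5 Prop. 5.1(c)] -/
theorem hasAdditiveReductionAt_two_mk_pow_mul_odd (hv : natGenerator v = 2) {r : ℕ} (hr : r < 4)
    {A₀ : ℤ} (hA₀ : Odd A₀) :
    (⟨0, 0, 0, (2 : ℚ) ^ r * A₀, 0⟩ : WeierstrassCurve ℚ).HasAdditiveReductionAt v := by
  have h2A₀ : ¬ ((natGenerator v : ℕ) : ℤ) ∣ A₀ := by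
    rw [hv]; intro h
    exact Int.not_even_iff_odd.mpr hA₀ (even_iff_two_dvd.mpr (by exact_mod_cast h))
  by_cases hr2 : r = 2
  · subst hr2
    have : ((2 : ℚ) ^ 2 * A₀) = 4 * (A₀ : ℚ) := by norm_num
    rw [this]
    exact hasAdditiveReductionAt_two_mk_four_mul_odd v hv hA₀
  set M : WeierstrassCurve ℚ := ⟨0, 0, 0, (2 : ℚ) ^ r * A₀, 0⟩ with hM
  have hΔM : M.Δ = (natGenerator v : ℚ) ^ (6 + 3 * r) * ((-(A₀ ^ 3) : ℤ) : ℚ) := by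
    rw [hv]
    simp only [hM, WeierstrassCurve.Δ, WeierstrassCurve.b₂, WeierstrassCurve.b₄,
      WeierstrassCurve.b₆, WeierstrassCurve.b₈]
    push_cast
    ring
  have h2A₀3 : ¬ ((natGenerator v : ℕ) : ℤ) ∣ -(A₀ ^ 3) := fun h ↦
    h2A₀ ((Rat.prime_natGenerator_int v).dvd_of_dvd_pow (Int.dvd_neg.mp h))
  have hΔ : v.valuation ℚ M.Δ = WithZero.exp (-((6 + 3 * r : ℕ) : ℤ)) := by
    rw [hΔM]
    exact WeierstrassCurve.Rat.valuation_pow_mul_intCast v h2A₀3 (6 + 3 * r)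
  have hc₄M : M.c₄ = (natGenerator v : ℚ) ^ (4 + r) * ((-3 * A₀ : ℤ) : ℚ) := by
    rw [hv]
    simp only [hM, WeierstrassCurve.c₄, WeierstrassCurve.b₂, WeierstrassCurve.b₄]
    push_cast
    ring
  have h23A₀ : ¬ ((natGenerator v : ℕ) : ℤ) ∣ -3 * A₀ := by
    intro h
    rcases (Rat.prime_natGenerator_int v).dvd_or_dvd h with h3 | h3
    · rw [hv] at h3; norm_num at h3
    · exact h2A₀ h3
  have hc₄ : v.valuation ℚ M.c₄ ^ 3 ≤ v.valuation ℚ M.Δ := by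
    rw [hc₄M, hΔ, WeierstrassCurve.Rat.valuation_pow_mul_intCast v h23A₀ (4 + r),
      ← WithZero.exp_nsmul, WithZero.exp_le_exp, smul_neg, nsmul_eq_mul]
    push_cast
    omega
  refine hasAdditiveReductionAt_of_valuation_Δ_of_cube_le v M ?_ ?_ ?_ ?_ ?_ hΔ ?_ hc₄
  · simp only [hM, Valuation.map_zero]; exact zero_le
  · simp only [hM, Valuation.map_zero]; exact zero_le
  · simp only [hM, Valuation.map_zero]; exact zero_le
  · show v.valuation ℚ ((2 : ℚ) ^ r * A₀) ≤ 1
    exact_mod_cast Rat.valuation_intCast_le_one v (2 ^ r * A₀)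
  · simp only [hM, Valuation.map_zero]; exact zero_le
  · interval_cases r <;> omega

/-- **`L_2(W) = 1` for every elliptic `W/ℚ` with `j(W) = 1728`** (additive reduction at `2` of
all the curves `y² = x³ + Ax`; Silverman, *Advanced Topics*, Ex. 2.31(a), 2.32(a) for
`K = ℚ(i)`, `p = 2`: `L_2(E/ℚ, T) = 1`). [cite: SilvermanATAEC1994, Ch. II Exercises 2.31(a), 2.32(a) (PDF p. 179)] -/
theorem localEulerFactor_eq_one_of_j_eq_1728_rat (W : WeierstrassCurve ℚ) [W.IsElliptic]
    (hj : W.j = 1728) (hv : natGenerator v = 2) :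
    (W.baseChange (v.adicCompletion ℚ)).localEulerFactor (v.adicCompletionIntegers ℚ) = 1 := by
  obtain ⟨r, A₀, C, hr, hA₀, hC⟩ := exists_variableChange_eq_of_j_eq_1728 W hj
  have hadd := hasAdditiveReductionAt_two_mk_pow_mul_odd v hv hr hA₀
  have hL := localEulerFactor_eq_one_of_hasAdditiveReductionAt v _ hadd
  rw [← hC] at hL
  haveI : (W.baseChange (v.adicCompletion ℚ)).IsElliptic := by rw [baseChange]; infer_instance
  simpa only [baseChange, ← map_variableChange, localEulerFactor_smul] using hL

end RatSide

/-! ### The `K`-side reduced to the odd case, and Deuring from `hI` + the odd case -/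

section KSide

/-- **`h1728` from the odd case over `K`.** Suppose that for every odd `m` and every place `w`
of ramification index `2` of the CM field `K ≅ ℚ(i)` of `j = 1728` the local Euler factor of
`(y² = x³ + mx)_K` at `w` is `1` (hypothesis `hβ`: additive reduction over `𝓞_w ≅ ℤ₂[i]`, where
`ord_w Δ = 12`). Then for every elliptic `W/ℚ` with `j(W) = 1728` both `L_w(W_K) = 1` and
`L_2(W) = 1`: the `ℚ`-side is `localEulerFactor_eq_one_of_j_eq_1728_rat`; on the `K`-side,
`W ≅ y² = x³ + 2^r A₀ x` (`exists_variableChange_eq_of_j_eq_1728`); `r = 1, 3` by the engine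
`localEulerFactor_eq_one_of_integral_model` (`6 ∤ 9, 15`); `r = 0` is `hβ`; and `r = 2` is
`K`-isomorphic to `r = 0` by `u = 1 + θ/2` (`θ² = -4`, `u⁴ = -4`:
`y² = x³ + 4A₀x ≅ y² = x³ - A₀x`). [cite: SilvermanATAEC1994, Ch. II Exercises 2.31(a), 2.32 (PDF p. 179)] -/
theorem h1728_of_odd
    (hβ : ∀ (m : ℤ), Odd m → ∀ (K : Type) [Field K] [NumberField K], IsCMFieldOfJ K 1728 →
      ∀ w : HeightOneSpectrum (𝓞 K), w.asIdeal.ramificationIdx (𝓞 ℚ) = 2 →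
        (((⟨0, 0, 0, (m : ℚ), 0⟩ : WeierstrassCurve ℚ).baseChange K).baseChange
          (w.adicCompletion K)).localEulerFactor (w.adicCompletionIntegers K) = 1) :
    ∀ (W : WeierstrassCurve ℚ) [W.IsElliptic], W.j = 1728 →
      ∀ (K : Type) [Field K] [NumberField K], IsCMFieldOfJ K W.j →
        ∀ w : HeightOneSpectrum (𝓞 K), w.asIdeal.ramificationIdx (𝓞 ℚ) = 2 →
          ((W.baseChange K).baseChange (w.adicCompletion K)).localEulerFactor
              (w.adicCompletionIntegers K) = 1 ∧
            (W.baseChange ((w.under (𝓞 ℚ)).adicCompletion ℚ)).localEulerFactor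
              ((w.under (𝓞 ℚ)).adicCompletionIntegers ℚ) = 1 := by
  intro W _ hj K _ _ hK w he
  rw [hj] at hK
  set v := w.under (𝓞 ℚ) with hv_def
  -- `p = 2`
  have hpd := natGenerator_dvd_cmFieldDiscr_of_ramificationIdx_eq_two
    (show (1728 : ℚ) ∈ maximalCMJInvariants by simp [maximalCMJInvariants]) K hK w he
  norm_num [cmFieldDiscr] at hpd
  have hv : natGenerator v = 2 := by
    have h4 : (natGenerator v : ℤ) ∣ 2 ^ 2 := by norm_num; exact hpd
    exact Rat.natGenerator_eq_of_dvd v Nat.prime_two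
      (by exact_mod_cast (Rat.prime_natGenerator_int v).dvd_of_dvd_pow h4)
  refine ⟨?_, localEulerFactor_eq_one_of_j_eq_1728_rat v W hj hv⟩
  -- the `K`-side
  obtain ⟨r, A₀, C, hr, hA₀, hC⟩ := exists_variableChange_eq_of_j_eq_1728 W hj
  haveI : ((W.baseChange K).baseChange (w.adicCompletion K)).IsElliptic := by
    rw [baseChange, baseChange, map_map]; infer_instance
  -- transfer along `C • W = M`
  have htransfer : ∀ M : WeierstrassCurve ℚ, C • W = M →
      ((M.baseChange K).baseChange (w.adicCompletion K)).localEulerFactor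
        (w.adicCompletionIntegers K) = 1 →
      ((W.baseChange K).baseChange (w.adicCompletion K)).localEulerFactor
        (w.adicCompletionIntegers K) = 1 := by
    intro M hM hL
    rw [← hM] at hL
    simpa only [baseChange, ← map_variableChange, localEulerFactor_smul] using hL
  have h2A₀ : ¬ ((natGenerator v : ℕ) : ℤ) ∣ A₀ := by
    rw [hv]; intro h
    exact Int.not_even_iff_odd.mpr hA₀ (even_iff_two_dvd.mpr (by exact_mod_cast h))
  -- `r = 1, 3`: the engine
  have hengine : r = 1 ∨ r = 3 →
      ((W.baseChange K).baseChange (w.adicCompletion K)).localEulerFactor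
        (w.adicCompletionIntegers K) = 1 := by
    intro hr13
    set M : WeierstrassCurve ℚ := ⟨0, 0, 0, (2 : ℚ) ^ r * A₀, 0⟩ with hM
    have hΔM : M.Δ = (natGenerator v : ℚ) ^ (6 + 3 * r) * ((-(A₀ ^ 3) : ℤ) : ℚ) := by
      rw [hv]
      simp only [hM, WeierstrassCurve.Δ, WeierstrassCurve.b₂, WeierstrassCurve.b₄,
        WeierstrassCurve.b₆, WeierstrassCurve.b₈]
      push_cast
      ring
    have h2A₀3 : ¬ ((natGenerator v : ℕ) : ℤ) ∣ -(A₀ ^ 3) := fun h ↦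
      h2A₀ ((Rat.prime_natGenerator_int v).dvd_of_dvd_pow (Int.dvd_neg.mp h))
    have hΔ : v.valuation ℚ M.Δ = WithZero.exp (-((6 + 3 * r : ℕ) : ℤ)) := by
      rw [hΔM]
      exact WeierstrassCurve.Rat.valuation_pow_mul_intCast v h2A₀3 (6 + 3 * r)
    have hc₄M : M.c₄ = (natGenerator v : ℚ) ^ (4 + r) * ((-3 * A₀ : ℤ) : ℚ) := by
      rw [hv]
      simp only [hM, WeierstrassCurve.c₄, WeierstrassCurve.b₂, WeierstrassCurve.b₄]
      push_cast
      ring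
    have h23A₀ : ¬ ((natGenerator v : ℕ) : ℤ) ∣ -3 * A₀ := by
      intro h
      rcases (Rat.prime_natGenerator_int v).dvd_or_dvd h with h3 | h3
      · rw [hv] at h3; norm_num at h3
      · exact h2A₀ h3
    have hc₄ : v.valuation ℚ M.c₄ ^ 3 ≤ v.valuation ℚ M.Δ := by
      rw [hc₄M, hΔ, WeierstrassCurve.Rat.valuation_pow_mul_intCast v h23A₀ (4 + r),
        ← WithZero.exp_nsmul, WithZero.exp_le_exp, smul_neg, nsmul_eq_mul]
      push_cast
      omega
    refine (localEulerFactor_eq_one_of_integral_model K w W M C hC he ?_ ?_ ?_ ?_ ?_ hΔ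
      (by rcases hr13 with rfl | rfl <;> omega) hc₄).1
    · simp only [hM, Valuation.map_zero]; exact zero_le
    · simp only [hM, Valuation.map_zero]; exact zero_le
    · simp only [hM, Valuation.map_zero]; exact zero_le
    · show v.valuation ℚ ((2 : ℚ) ^ r * A₀) ≤ 1
      exact_mod_cast Rat.valuation_intCast_le_one v (2 ^ r * A₀)
    · simp only [hM, Valuation.map_zero]; exact zero_le
  interval_cases r
  · -- `r = 0`: the odd case
    refine htransfer ⟨0, 0, 0, (A₀ : ℚ), 0⟩ (by rw [hC]; norm_num) ?_
    exact hβ A₀ hA₀ K hK w he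
  · exact hengine (Or.inl rfl)
  · -- `r = 2`: over `K`, `y² = x³ + 4A₀x ≅ y² = x³ - A₀x` by `u = 1 + θ/2`, `u⁴ = -4`
    obtain ⟨hK2, θ, hθ⟩ := hK
    norm_num [cmFieldDiscr] at hθ
    set u : K := 1 + θ / 2 with hu_def
    have hu4 : u ^ 4 = -4 := by
      rw [hu_def]
      linear_combination (θ ^ 2 / 16 + θ / 2 + 5 / 4) * hθ
    have hu : u ≠ 0 := by
      intro h; rw [h] at hu4; norm_num at hu4
    have hiso : (⟨Units.mk0 u hu, 0, 0, 0⟩ : VariableChange K) •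
        (⟨0, 0, 0, (2 : ℚ) ^ 2 * A₀, 0⟩ : WeierstrassCurve ℚ).baseChange K =
          (⟨0, 0, 0, ((-A₀ : ℤ) : ℚ), 0⟩ : WeierstrassCurve ℚ).baseChange K := by
      have hu4' : (u ^ 4)⁻¹ = -4⁻¹ := by rw [hu4, inv_neg]
      ext
      · simp [variableChange_a₁, baseChange]
      · simp [variableChange_a₂, baseChange]
      · simp [variableChange_a₃, baseChange]
      · simp only [variableChange_a₄, baseChange, map_a₁, map_a₂, map_a₃, map_a₄,
          Units.val_inv_eq_inv_val, Units.val_mk0, inv_pow, hu4', map_zero, map_mul, map_pow,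
          map_intCast, map_neg, map_ofNat, mul_zero, sub_zero, add_zero, Int.cast_neg]
        ring
      · simp [variableChange_a₆, baseChange]
    refine htransfer ⟨0, 0, 0, (2 : ℚ) ^ 2 * A₀, 0⟩ hC ?_
    have hodd : Odd (-A₀) := hA₀.neg
    have hL := hβ (-A₀) hodd K ⟨hK2, θ, by norm_num [cmFieldDiscr]; exact hθ⟩ w he
    haveI : (⟨0, 0, 0, (2 : ℚ) ^ 2 * A₀, 0⟩ : WeierstrassCurve ℚ).IsElliptic := by
      rw [← hC]; infer_instance
    rw [← hiso] at hL
    simpa only [baseChange, ← map_variableChange, localEulerFactor_smul] using hL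
  · exact hengine (Or.inr rfl)

/-- **Deuring's `L(E_K/K, s) = L(E/ℚ, s)²` from the inert leaf and the odd case at `j = 1728`
over `K`** (`Deuring_LFunction_baseChange_cmField_of_inert_of_j1728` with `h1728_of_odd`).
[cite: SilvermanATAEC1994, Ch. II Thm. 10.5 (a), (b) (PDF p. 171)] -/
theorem Deuring_LFunction_baseChange_cmField_of_inert_of_odd
    (hI : ∀ (W : WeierstrassCurve ℚ) [W.IsElliptic], W.j ∈ maximalCMJInvariants →
      ∀ (K : Type) [Field K] [NumberField K], IsCMFieldOfJ K W.j →
        ∀ w : HeightOneSpectrum (𝓞 K), w.asIdeal.inertiaDeg (𝓞 ℚ) = 2 →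
          ((W.baseChange K).baseChange (w.adicCompletion K)).localEulerFactor
              (w.adicCompletionIntegers K) =
            (W.baseChange ((w.under (𝓞 ℚ)).adicCompletion ℚ)).localEulerFactor
              ((w.under (𝓞 ℚ)).adicCompletionIntegers ℚ) ^ 2)
    (hβ : ∀ (m : ℤ), Odd m → ∀ (K : Type) [Field K] [NumberField K], IsCMFieldOfJ K 1728 →
      ∀ w : HeightOneSpectrum (𝓞 K), w.asIdeal.ramificationIdx (𝓞 ℚ) = 2 →
        (((⟨0, 0, 0, (m : ℚ), 0⟩ : WeierstrassCurve ℚ).baseChange K).baseChange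
          (w.adicCompletion K)).localEulerFactor (w.adicCompletionIntegers K) = 1) :
    Deuring_LFunction_baseChange_cmField :=
  Deuring_LFunction_baseChange_cmField_of_inert_of_j1728 hI (h1728_of_odd hβ)

end KSide

end Literature.NumberTheory.EllipticCurves

end
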